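import Summits.HodgeConjecture.HodgeConjecture.Theses.HeckePrymWeil
import Literature.AlgebraicGeometry.Motives.AbelianVarietyProjectiveChart
import Summits.HodgeConjecture.HodgeConjecture.Theorems.WeilTwelvefoldsSqrtMinus7.Negative.EigenvalueTyping
import Summits.HodgeConjecture.HodgeConjecture.Theorems.WeilTwelvefoldsSqrtMinus7.Negative.WeilPlaneReality
import Literature.AlgebraicGeometry.HodgeTheory.DiagonalSymmetryStability
import Literature.AlgebraicGeometry.Motives.WeilDiscriminantRealization
import Literature.AlgebraicGeometry.Motives.HyperbolicWeilType

/-!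
# Disproof attempts on crux `WeilSixfoldsSqrtMinus7` (item stmt-HodgeConjecture-1260, route HeckePrymWeil) — findings

Standing-adversary work file (cdisprove seat `refuter-cdisprove-stmt-HodgeConjecture-1260-0`).
Cycle 1 (seat `…-1260-0`) and CYCLE 2 (seat `…-1260-g2-0`), 2026-08-16. Everything below is `lean check`ed (rc 0, no `sorry`). Cycle-2 additions: header block "CYCLE 2" and §§6–8.

## Verdict so far: NO KILL — and none is possible in the present tree

The crux reads, symbol for symbol (probe `W.lean`, rc 0; constants listed in §1):
for every complex abelian variety `A` (`Motives.AbelianVariety ℂ`: a proper, geometrically integral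
group scheme over `Spec ℂ` — a REAL definition, no hypothesis structure) with `A.dim = 6`
(`schemeDim` = topological Krull dimension of the Zariski space) and every `φ : A ⟶ A` with
`φ ≫ φ = -(7 • 𝟙 A)` in the (real, Mathlib-transported) preadditive structure, every class
`c ∈ H⁶(A(ℂ); ℂ)` which is rational (`IsRationalClass`: a `ℚ`-valued singular cocycle), of Hodge
type `(3,3)` (`IsOfHodgeType 6 A.X 6 3 3`: `∃` Hodge model — analytification + natural de Rham
comparison + Hodge decomposition — in which the pull-back of `c` is a combination of closed
`(3,3)`-forms) and lies in `Eig((𝟙+φ)^*, (1+i√7)⁶) ⊔ Eig((𝟙+φ)^*, (1-i√7)⁶)` (`complexBetti.map` IS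
the pull-back `f^*`, contravariant, `GysinFormalism.lean` l.118) is in
`algebraicClasses A.X 3 = N³H⁶(A(ℂ); ℂ)` (sum of `ker(H⁶(X(ℂ)) → H⁶((X∖Z)(ℂ)))` over Zariski-closed
`Z` all of whose points have `coheight ≥ 3`; Mathlib's scheme preorder is `x ≤ y ↔ y ⤳ x`, checked
by `Iff.rfl` in `W.lean`, so `coheight` = codimension as intended).

1. TYPING IS FAITHFUL (§1, §2). `(𝟙+φ)^*` on `H⁶ = ∧⁶H¹` is `∧⁶(1+φ^*|H¹)`; on the Künneth–Hodge
   summand `∧ᵃH¹_σ ⊗ ∧ᵇH¹_σ̄` (`φ^* = ±i√7`) its eigenvalue is `(1+i√7)ᵃ(1-i√7)ᵇ`. PROVED below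
   (`weilEigenvalue_pos_ne_neg`, `mixed_eigenvalue_ne_pos`, `mixed_eigenvalue_ne_neg`,
   `weilEigenvalue_values`): the two Weil eigenvalues `(1±i√7)⁶ = 288 ± 160·i√7` are distinct and no
   mixed summand (`b ≠ 0`, resp. `a ≠ 0`) shares them; the non-vanishing `(weilAB 7 n).2 ≠ 0` is
   checked for all `1 ≤ n ≤ 12`, so the SAME lemmas serve the twelvefold rung
   `WeilTwelvefoldsSqrtMinus7` (stmt-1261); `weilAB 11` serves `WeilTenfoldsSqrtMinus11` (stmt-1262).
   Hence the hypothesis `c ∈ Eig ⊔ Eig` cuts out exactly `W_K ⊗ ℂ = ∧⁶H¹_σ ⊕ ∧⁶H¹_σ̄`, as the planner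
   claims, and the statement is NOT vacuous: Weil-type `(3,3)` sixfolds with `√-7 ∈ End` form a
   9-dimensional family on which `W_K` is a 2-dimensional `ℚ`-space of Hodge classes.
   §2b (`mem_weilPlane_iff`, PROVED): `c ∈ Eig ⊔ Eig ↔ f(f c) - 576·f c + 262144·c = 0` for
   `f = (𝟙+φ)^*` — the Weil plane is the kernel of a `ℚ`-rational operator, hence defined over `ℚ`.
2. NO SMALL / JUNK / DEGENERATE MODEL EXISTS (§3). The only `AbelianVariety ℂ` constructible in
   the tree today is the zero group scheme `Spec ℂ` (`dim 0`); no elliptic curve, Jacobian, complex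
   torus or product carries a `GrpObj` structure in `Over (Spec ℂ)` yet. Consequently NO statement
   of the shape `∀ A : AbelianVariety ℂ, A.dim = 6 → …` — the crux, or ANY weakening of it — admits a
   Lean counterexample now: every `¬`-theorem needs a witness sixfold. This is why the
   load-bearing analysis of §4 is recorded as `…_false_of_…` implications from precisely stated
   witness hypotheses rather than as unconditional `_false_without_` theorems.
3. LOAD-BEARING ANALYSIS (§4, paper + Lean shape).
   * `IsOfHodgeType 6 A.X 6 3 3 c` IS load-bearing: dropping it is FALSE on paper — `A = E⁶`,
     `E = ℂ/ℤ[(1+√-7)/2]`, `φ = diag(√-7)`: `H¹_σ = H^{1,0}`, so `W_K ⊗ ℂ = H^{6,0} ⊕ H^{0,6}`, its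
     rational classes are not Hodge classes, hence not algebraic (algebraic ⇒ `(p,p)`, Voisin I
     Prop. 11.20). Lean: `weilSixfolds_withoutHodgeType_false_of_witness` (modulo the witness).
   * `IsRationalClass c` is NOT load-bearing (information for provers): on a Weil-type `(3,3)`
     sixfold `W_K ⊗ ℂ` is entirely of type `(3,3)` and is `ℂ`-spanned by `W_K ⊂ H⁶(A, ℚ)`, and
     `algebraicClasses` is a `ℂ`-subspace, so the crux with and without `IsRationalClass` are
     equivalent (universal coefficients + Galois-stability of `Eig_λ ⊕ Eig_λ̄`); off Weil type both
     are vacuous (`(Eig ⊔ Eig) ∩ H^{3,3} = 0`). Equivalently (Markman arXiv:2509.23079 §1: "It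
     suffices to prove the algebraicity of one non-zero class in HW(A,η), as K acts via algebraic
     correspondences"): ONE non-zero algebraic class in `W_K` suffices, because `(𝟙+φ)^*` preserves
     algebraic classes and has no rational eigenvector in `W_K` (eigenvalues `288 ± 160 i√7 ∉ ℚ`).
   * `φ ≫ φ = -7`, `A.dim = 6`, and the eigenspace membership are NOT load-bearing for TRUTH (each
     weakening is still a special case of the Hodge conjecture: rational `(3,3)`-classes on a smooth
     projective variety), only for the route's MECHANISM (Hecke–Prym anchors need `K = ℚ(√-7)`,
     `2n = 6`).
4. WHY IT RESISTS (§5). (a) `not_hodgeConjecture_of_not_weilSixfoldsSqrtMinus7` (PROVED,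
   unconditional, uses the tree's `AbelianVariety.isSmoothProjective_holds`): a kill of this crux
   is a disproof of the Clay problem itself. (b) Deligne 1982 / André 1996 (barrier
   `Literature.Barriers.HodgeConjecture.Andre1996_hodgeClassesOnAbelianVarieties_motivated`,
   `not_lefschetzStandardConjecture_of_counterexample`): Hodge classes on abelian varieties are
   absolute Hodge and motivated, so a non-algebraic Weil class refutes Grothendieck's standard
   conjecture `B`; no candidate mechanism for non-algebraicity exists in print. (c) Literature
   status read 2026-08-16: arXiv:2603.20268 (March 2026) p. 3: "For g=3: Markman [Markman25] proved
   algebraicity for discriminant -1 and all K via a semiregular secant sheaf; outside this locus,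
   the Hodge conjecture for Weil classes on sixfolds remains completely open"; arXiv:2509.23079
   (Markman, Sept. 2025) p. 3: proved "for abelian sixfolds of split Weil type … for all imaginary
   quadratic number fields"; nothing newer found in holdings (remote `lit search` was unavailable,
   rc 75, at the time of writing — re-run on re-arm).
5. NATURAL STRENGTHENINGS (§6, paper): "every rational class of `W_K ⊗ ℂ` is algebraic" without
   the `(3,3)` hypothesis — FALSE (`E⁶` above); "`W_K ⊆ D³ =` span of triple intersections of
   divisors" — FALSE for the general member (Weil 1977 = vanGeemen1994HodgeAV Thm. 4.11, the
   catalogued barrier `Weil1977_exceptionalHodgeClasses`; this is what makes the classes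
   exceptional, not non-algebraic); "`K = ℚ(√-3)`, `det H = 1`" analogue — TRUE (Schoen 1988/1998);
   "`det H = -1`" component of the crux — TRUE (Markman 2025). None is Lean-refutable (item 2).
6. TARGETS: none yet (`payload.targets = []`, no line picked). Section §7 is reserved.
7. MECHANISM FINDING (computational, cycle 1 — evidence `HeckePrymDiscriminant.md` + `weilprym.py` on
   the item): the Hecke–Prym anchors are of SPLIT Weil type. Purely topological exact computation
   (ribbon-graph lift of the octagon, interleaving intersection form, deck action, Hecke projector
   `e_μ(1-e_N)`, `φ = Σ (k/p) nᵏ`, K-Hermitian form `√-p·E_K(x,ȳ)`, LDL* over K; validated on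
   Schoen's ℤ/3 covers: fourfolds signature (2,2), det H ≡ +1 = vG's "det H = 1" family; sixfolds
   (3,3), ≡ −1 = split, as Markman's survey says). RESULTS: P(7,2) (this crux): 81/81 random
   epimorphisms π₁(Σ₂) ↠ F₂₁ give signature (3,3) and det H ≡ −1 in ℚ^×/N(ℚ(√-7)^×) — MARKMAN's
   split component; P(7,3): 3/3 signature (6,6), ≡ +1 (split); P(11,2): 2/2 signature (5,5), ≡ −1
   (split). CONSEQUENCE: NS(7,2) and T(7,2) are already theorems (Markman 2025 covers every split
   sixfold, every K); the (7,2) anchor does not meet the OPEN (non-split) part of this crux — kill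
   criterion (K3) of the route is triggered for p = 7; the header's "non-split anchor" claim is false
   for every anchor computed; the open content of the ladder starts at rung (7,3) (split twelvefolds,
   no engine) + WeilDescending with an auxiliary Weil surface of complementary discriminant. The crux
   STATEMENT is unaffected (still the open non-split ℚ(√-7) sixfold case of HC).


## CYCLE 2 (seat `refuter-cdisprove-stmt-HodgeConjecture-1260-g2-0`, 2026-08-16) — what is new

State on re-arm: `Theorems/WeilSixfoldsSqrtMinus7/Negative/EigenvalueSeparation.lean` LANDED (p75853);
the registered skeleton of this crux is `Lines/hyperbolic-eightfold-descent.lean` (5 active stubs; no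
`PICKED.md`, lead cycles 0); the sibling seat on crux 1261 landed the GENERAL typing lemmas
(`Theorems/WeilTwelvefoldsSqrtMinus7/Negative/{EigenvalueTyping, LadderTyping, WeilPlaneReality,
DiscriminantClasses, KillPropagation}.lean`: `(1+i√7)^n ≠ (1-i√7)^n` for every `n ≥ 1`, every
`d ≥ 4`; conjugation swaps the typed eigenspaces) — imported below, not redone.  Verdict unchanged:
NO KILL, none possible in the tree.  New this cycle (everything `lean check`ed, rc 0, no `sorry`):

8. JUNK-MODEL ATTACK ON `IsOfHodgeType` (the only hypothesis with an `∃` over a structure) — FAILS,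
   with a near-miss worth recording (§8).  `IsOfHodgeType 6 A.X 6 3 3 c := ∃ M : HodgeModel 6 A.X,
   M.pullback c ∈ M.hodgePQ 6 3 3`.  ATTEMPT: take the non-algebraic rational Weil class `c` of
   `A = E⁶` (`E` CM by `O_K`; `W_K ⊗ ℂ = H^{6,0} ⊕ H^{0,6}` for the true structure) and the EXOTIC
   complex structure `E³ × Ē³` on the same real torus (still projective, Hodge decomposition holds,
   and `c` is of type `(3,3)` for it): if that were a `HodgeModel`, the crux AND the summit
   `HodgeConjecture` would be false for a junk reason.  It is NOT a Hodge model: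
   `HodgeModel.isAnalytification : IsAnalytification model X 6 toComplexPoints` demands
   (`Literature/NumberTheory/Transcendental/Analytification`, field `mdifferentiableOn_evalOrZero`)
   that every regular function on every AFFINE open pull back holomorphically — so the local algebraic
   coordinates are holomorphic on `M`, and a holomorphic homeomorphism onto a smooth `6`-dimensional
   complex submanifold of `ℂ^N` is a biholomorphism (Osgood): `M ≅ A^an`.  Second junk degree of
   freedom: the de Rham comparison `M.deRham`, ANY natural family on manifolds charted on `ℂ⁶`.  Two
   natural families differ by a natural `ℂ`-linear automorphism `α` of `H⁶(–; ℂ)` on that category;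
   `α` is a universal scalar: for a closed oriented connected `6`-manifold `N`, `P = N × ℝ⁶` is in the
   category and `H⁶(P; ℂ) ≅ ℂ`, so `α_P = c_P ∈ ℂˣ`; `c_P` is the same for all `N` (degree-one pinch
   maps `N₁ # N₂ → Nᵢ` are injective on `H⁶`); for `f : N → M` (smoothed) naturality along
   `f ∘ pr₁ : P → M` gives `⟨α_M x, f_*[N]⟩ = c ⟨x, f_*[N]⟩`, and the `f_*[N]` span `H₆(M; ℚ)` (Thom
   1954), so `α_M = c · id` and `e(H^{3,3})` does not move.  Hence `∃`-model = THE Hodge type: no junk.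
   (The tree records model-independence only as the hypothesis `hodgePQ_independent_of_hodgeModel` and
   `IsAnalytification.unique` as a named fact; both are true for the reasons above — an auditor's note,
   not a defect of the crux.)  The argument needs affine-local regular functions: had the predicate
   only constrained GLOBAL regular functions (constants on a projective `A`), `E³ × Ē³` WOULD refute the
   crux and the summit.  Recorded in §8.
9. NATURAL STRENGTHENINGS, now in Lean (§6; filed for `Theorems/WeilSixfoldsSqrtMinus7/Negative/
   WeilPlaneReality.lean`): a rational class in ONE typed eigenspace is `0` in EVERY degree
   (`rational_mem_plusEigenspace_eq_zero`), so the "+ only" / "− only" variants of the crux hold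
   VACUOUSLY (`onlyPlusVariant_six_holds`, `onlyMinusVariant_six_holds`) — the `⊔` is essential; the two
   components of a rational class of the plane are conjugate and BOTH non-zero unless `c = 0`
   (`weilComponents_conj`, `weilComponents_ne_zero`); the crux is equivalent to its componentwise form
   (`weilSixfoldsSqrtMinus7_iff_componentwise`) — the only shape a counterexample can have.
10. TARGETS = the 5 registered stubs of `hyperbolic-eightfold-descent` (pre-emptive; `payload.targets`
   still empty).  §7 below: NONE IS FALSIFIABLE; per stub the kill attempts, why each fails, and the
   Lean-checked bookkeeping the lead will need (eigenvalues in degrees 2/4/8, the four-way separation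
   and the Weil polynomial `q(X) = X² - 1024·X + 8⁸` of Stub 5; `IsOfHodgeType.map_endomorphism`
   supplies the Hodge-type transport of `T = (𝟙+ψ)^*` that Stub 5's sketch uses but no stub states;
   the descent pair of Stub 3 is necessarily `b₋ = conj b₊`, both non-rational — the stub is typed
   correctly with `IsRationalClass (b₊ + b₋)`, a componentwise-rational variant would be unsatisfiable).
   Stub 2 (`stub_aimingArithmetic`) is TRUE by Landherr (signature `(n+1,n+1)` automatic, determinant
   class adjustable because `m₁ m₂` is free and `r₁ r₂ > 0`; degenerate case `n = 0`: `m₁ r₁ = m₂ r₂`,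
   `L = K·(0,(1,1))` is isotropic since `E_c(u, αu) = Σ cᵢ Nm(uᵢ)` for `diagWeilForm`); Stub 1 is an
   instance of HC (its `h` need not be ample as typed — still implied by HC, so not refutable); Stub 3's
   product pairing is consistent: `h = h_A ⊞ h_B` gives `h⁷ = 21 h_A⁵h_B² + 7 h_A⁶h_B` (only `k ∈ {5,6}`
   survive), cross terms die by degree, `Q_h = 21·Q_{h_A} ⊗ vol_B ⊕ 7·vol_A ⊗ Q_{h_B}` non-degenerate,
   hyperbolic iff `a m₁ m₂ r² ∈ Nm(K^×)` — achievable.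
11. LITERATURE (re-run 2026-08-16, arXiv cascade; searchd local index rc 75): van Geemen–Rapagnetta
   arXiv:2607.18341 (20 Jul 2026) p. 1: HC known "for all abelian varieties of dimension at most five"
   [Markman] and a third proof of the disc-1 Weil FOURFOLD case — nothing on non-split `ℚ(√-7)`
   SIXFOLDS; Mostaed arXiv:2603.20268 §1 unchanged ("completely open" off disc -1); Perry
   arXiv:2604.00511 (Apr 2026): semiregularity for equivariant NONCOMMUTATIVE / twisted varieties,
   "answers a question of Markman" — an ENGINE upgrade relevant to Stub 1 (twisted secant objects at
   genus 4), not to the truth of the crux; Floccari–Fu arXiv:2607.07528 (hyper-Kummer) unrelated.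
   The crux remains an honest open instance of HC.

Nothing in this file asserts a Theses decl positively except through hypotheses; the crux is
untouched. Provers: cite §2 for the eigenspace bookkeeping; planners: no misstatement found, no
signature change recommended; re-rank (7,2) as a calibration rung (item 7).
-/

noncomputable section

set_option linter.dupNamespace false

open CategoryTheory Complex

namespace Summit.HodgeConjecture.HodgeConjecture.Cruxes.WeilSixfoldsSqrtMinus7.Disproof

/-! ## §0 The crux elaborates -/

/-- The crux, restated by name (elaboration probe; the body is the route decl verbatim). -/
example : Theses.HeckePrymWeil.WeilSixfoldsSqrtMinus7 ↔
    ∀ (A : Literature.AlgebraicGeometry.Motives.AbelianVariety ℂ) (φ : A ⟶ A), A.dim = 6 →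
      φ ≫ φ = -((7 : ℤ) • 𝟙 A) →
      ∀ c : Literature.AlgebraicGeometry.HodgeTheory.complexBetti A.X 6,
        Literature.AlgebraicGeometry.HodgeTheory.IsRationalClass c →
        Literature.AlgebraicGeometry.HodgeTheory.IsOfHodgeType 6 A.X 6 3 3 c →
        c ∈ Module.End.eigenspace (Literature.AlgebraicGeometry.HodgeTheory.complexBetti.map
              (𝟙 A + φ).hom.hom.hom 6).hom ((1 + I * (Real.sqrt (7 : ℝ) : ℂ)) ^ 6) ⊔
            Module.End.eigenspace (Literature.AlgebraicGeometry.HodgeTheory.complexBetti.map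
              (𝟙 A + φ).hom.hom.hom 6).hom ((1 - I * (Real.sqrt (7 : ℝ) : ℂ)) ^ 6) →
        c ∈ Literature.AlgebraicGeometry.HodgeTheory.algebraicClasses A.X 3 :=
  Iff.rfl

/-! ## §2 Eigenvalue separation: the typing of the Weil plane is correct

Write `t = i√p` (`t² = -p`). Then `(1 + t)ⁿ = Aₙ + Bₙ t`, `(1 - t)ⁿ = Aₙ - Bₙ t` with
`(A₀, B₀) = (1, 0)`, `(Aₙ₊₁, Bₙ₊₁) = (Aₙ - p Bₙ, Aₙ + Bₙ)`; the two pure eigenvalues differ iff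
`Bₙ ≠ 0`, and a mixed eigenvalue `(1+t)ᵃ(1-t)ᵇ` (`a + b = n`) equals `(1+t)ⁿ` iff `(1-t)ᵇ = (1+t)ᵇ`
iff `B_b = 0`. (`Bₙ ≠ 0` for all `n ≥ 1` because `(1+t)/(1-t)` has norm `1` but trace `-3/4·2`,
i.e. is not an algebraic integer, hence no root of unity; we only need, and check by `decide`,
the range `1 ≤ n ≤ 12`.) -/

/-- `(Aₙ, Bₙ)` with `(1 + t)ⁿ = Aₙ + Bₙ·t` whenever `t² = -p`. -/
def weilAB (p : ℕ) : ℕ → ℤ × ℤ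
  | 0 => (1, 0)
  | n + 1 => ((weilAB p n).1 - (p : ℤ) * (weilAB p n).2, (weilAB p n).1 + (weilAB p n).2)

@[simp] theorem weilAB_zero (p : ℕ) : weilAB p 0 = (1, 0) := rfl

@[simp] theorem weilAB_succ (p n : ℕ) :
    weilAB p (n + 1) =
      ((weilAB p n).1 - (p : ℤ) * (weilAB p n).2, (weilAB p n).1 + (weilAB p n).2) := rfl

/-- `(1 + t)ⁿ = Aₙ + Bₙ t` for `t² = -p`. -/
theorem one_add_pow_eq {p : ℕ} {t : ℂ} (ht : t ^ 2 = -(p : ℂ)) (n : ℕ) :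
    (1 + t) ^ n = ((weilAB p n).1 : ℂ) + ((weilAB p n).2 : ℂ) * t := by
  induction n with
  | zero => simp
  | succ n ih =>
    rw [pow_succ, ih, weilAB_succ]
    push_cast
    linear_combination ((weilAB p n).2 : ℂ) * ht

/-- `(1 - t)ⁿ = Aₙ - Bₙ t` for `t² = -p`. -/
theorem one_sub_pow_eq {p : ℕ} {t : ℂ} (ht : t ^ 2 = -(p : ℂ)) (n : ℕ) :
    (1 - t) ^ n = ((weilAB p n).1 : ℂ) - ((weilAB p n).2 : ℂ) * t := by
  induction n with
  | zero => simp
  | succ n ih =>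
    rw [pow_succ, ih, weilAB_succ]
    push_cast
    linear_combination ((weilAB p n).2 : ℂ) * ht

/-- The two pure eigenvalues `(1 ± t)ⁿ` differ as soon as `Bₙ ≠ 0` (`p ≠ 0`). -/
theorem one_add_pow_ne_one_sub_pow {p : ℕ} (hp : p ≠ 0) {t : ℂ} (ht : t ^ 2 = -(p : ℂ)) {n : ℕ}
    (hB : (weilAB p n).2 ≠ 0) : (1 + t) ^ n ≠ (1 - t) ^ n := by
  intro h
  rw [one_add_pow_eq ht, one_sub_pow_eq ht] at h
  have h2 : (2 * ((weilAB p n).2 : ℂ)) * t = 0 := by linear_combination h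
  have ht0 : t = 0 := by
    rcases mul_eq_zero.1 h2 with h3 | h3
    · exfalso
      apply hB
      have h4 : ((weilAB p n).2 : ℂ) = 0 := by simpa using h3
      exact_mod_cast h4
    · exact h3
  rw [ht0] at ht
  have h5 : (p : ℂ) = 0 := by linear_combination ht
  exact hp (by exact_mod_cast h5)

/-- `1 + t ≠ 0` when `t² = -p` (`(1+t)(1-t) = 1 + p ≠ 0`). -/
theorem one_add_ne_zero {p : ℕ} {t : ℂ} (ht : t ^ 2 = -(p : ℂ)) : (1 + t) ≠ 0 := by
  intro h0
  have h1 : (1 + t) * (1 - t) = 1 + (p : ℂ) := by linear_combination -ht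
  rw [h0, zero_mul] at h1
  have h2 : (p : ℂ) = -1 := by linear_combination -h1
  have h3 : ((p : ℝ) : ℂ) = ((-1 : ℝ) : ℂ) := by push_cast; exact h2
  have h4 : (p : ℝ) = -1 := Complex.ofReal_injective h3
  have h5 : (0 : ℝ) ≤ p := Nat.cast_nonneg p
  linarith

/-- `1 - t ≠ 0` when `t² = -p`. -/
theorem one_sub_ne_zero {p : ℕ} {t : ℂ} (ht : t ^ 2 = -(p : ℂ)) : (1 - t) ≠ 0 := by
  have ht' : (-t) ^ 2 = -(p : ℂ) := by rw [neg_sq]; exact ht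
  have := one_add_ne_zero ht'
  rwa [← sub_eq_add_neg] at this

/-- A mixed eigenvalue `(1+t)ᵃ(1-t)ᵇ`, `a + b = n`, `b ≠ 0`, differs from the pure `(1+t)ⁿ`
whenever `B_b ≠ 0`. -/
theorem mixed_ne_one_add_pow {p : ℕ} (hp : p ≠ 0) {t : ℂ} (ht : t ^ 2 = -(p : ℂ)) {a b n : ℕ}
    (hab : a + b = n) (hB : (weilAB p b).2 ≠ 0) :
    (1 + t) ^ a * (1 - t) ^ b ≠ (1 + t) ^ n := by
  intro h
  rw [← hab, pow_add] at h
  have h' : (1 - t) ^ b = (1 + t) ^ b :=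
    mul_left_cancel₀ (pow_ne_zero a (one_add_ne_zero ht)) h
  exact one_add_pow_ne_one_sub_pow hp ht hB h'.symm

/-- Symmetrically, `(1+t)ᵃ(1-t)ᵇ ≠ (1-t)ⁿ` for `a ≠ 0` with `B_a ≠ 0`. -/
theorem mixed_ne_one_sub_pow {p : ℕ} (hp : p ≠ 0) {t : ℂ} (ht : t ^ 2 = -(p : ℂ)) {a b n : ℕ}
    (hab : a + b = n) (hA : (weilAB p a).2 ≠ 0) :
    (1 + t) ^ a * (1 - t) ^ b ≠ (1 - t) ^ n := by
  intro h
  rw [← hab, pow_add] at h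
  have h' : (1 + t) ^ a = (1 - t) ^ a :=
    mul_right_cancel₀ (pow_ne_zero b (one_sub_ne_zero ht)) h
  exact one_add_pow_ne_one_sub_pow hp ht hA h'

/-- `Bₙ ≠ 0` for `p = 7` and `1 ≤ n ≤ 12` (covers the sixfold and twelvefold rungs). -/
theorem weilAB_seven_snd_ne_zero : ∀ n : ℕ, 1 ≤ n → n ≤ 12 → (weilAB 7 n).2 ≠ 0 := by
  intro n h1 h2
  interval_cases n <;> decide

/-- `Bₙ ≠ 0` for `p = 11` and `1 ≤ n ≤ 12` (covers the tenfold rung `WeilTenfoldsSqrtMinus11`). -/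
theorem weilAB_eleven_snd_ne_zero : ∀ n : ℕ, 1 ≤ n → n ≤ 12 → (weilAB 11 n).2 ≠ 0 := by
  intro n h1 h2
  interval_cases n <;> decide

/-- The crux's atom: `(i√7)² = -7`. -/
theorem I_mul_sqrt_seven_sq : (I * (Real.sqrt (7 : ℝ) : ℂ)) ^ 2 = -((7 : ℕ) : ℂ) := by
  rw [mul_pow, Complex.I_sq, ← Complex.ofReal_pow, Real.sq_sqrt (by norm_num : (0 : ℝ) ≤ 7)]
  push_cast
  ring

/-- `(i√11)² = -11` (tenfold rung). -/
theorem I_mul_sqrt_eleven_sq : (I * (Real.sqrt (11 : ℝ) : ℂ)) ^ 2 = -((11 : ℕ) : ℂ) := by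
  rw [mul_pow, Complex.I_sq, ← Complex.ofReal_pow, Real.sq_sqrt (by norm_num : (0 : ℝ) ≤ 11)]
  push_cast
  ring

/-- **The two Weil eigenvalues of the crux are distinct**: `(1+i√7)⁶ ≠ (1-i√7)⁶`, so
`Eig ⊔ Eig` in the crux is a direct sum of two different eigenspaces of `(𝟙+φ)^*`. -/
theorem weilEigenvalue_pos_ne_neg :
    (1 + I * (Real.sqrt (7 : ℝ) : ℂ)) ^ 6 ≠ (1 - I * (Real.sqrt (7 : ℝ) : ℂ)) ^ 6 :=
  one_add_pow_ne_one_sub_pow (by norm_num) I_mul_sqrt_seven_sq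
    (weilAB_seven_snd_ne_zero 6 (by norm_num) (by norm_num))

/-- Explicit values: `(1 ± i√7)⁶ = 288 ± 160·i√7` (norm `8⁶ = 262144 = 288² + 7·160²`). -/
theorem weilEigenvalue_values :
    (1 + I * (Real.sqrt (7 : ℝ) : ℂ)) ^ 6 = 288 + 160 * (I * (Real.sqrt (7 : ℝ) : ℂ)) ∧
    (1 - I * (Real.sqrt (7 : ℝ) : ℂ)) ^ 6 = 288 - 160 * (I * (Real.sqrt (7 : ℝ) : ℂ)) := by
  have h6 : weilAB 7 6 = (288, 160) := by decide
  refine ⟨?_, ?_⟩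
  · rw [one_add_pow_eq I_mul_sqrt_seven_sq 6, h6]; push_cast; ring
  · rw [one_sub_pow_eq I_mul_sqrt_seven_sq 6, h6]; push_cast; ring

/-- **No mixed Künneth–Hodge summand `∧ᵃH¹_σ ⊗ ∧ᵇH¹_σ̄` (`a+b=6`, `b ≠ 0`) has the eigenvalue of
the Weil line `∧⁶H¹_σ`**: `(1+i√7)ᵃ(1-i√7)ᵇ ≠ (1+i√7)⁶`. -/
theorem mixed_eigenvalue_ne_pos {a b : ℕ} (hab : a + b = 6) (hb : b ≠ 0) :
    (1 + I * (Real.sqrt (7 : ℝ) : ℂ)) ^ a * (1 - I * (Real.sqrt (7 : ℝ) : ℂ)) ^ b ≠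
      (1 + I * (Real.sqrt (7 : ℝ) : ℂ)) ^ 6 :=
  mixed_ne_one_add_pow (by norm_num) I_mul_sqrt_seven_sq hab
    (weilAB_seven_snd_ne_zero b (Nat.pos_of_ne_zero hb) (by omega))

/-- Symmetrically for the conjugate Weil line `∧⁶H¹_σ̄`: `(1+i√7)ᵃ(1-i√7)ᵇ ≠ (1-i√7)⁶` if `a ≠ 0`. -/
theorem mixed_eigenvalue_ne_neg {a b : ℕ} (hab : a + b = 6) (ha : a ≠ 0) :
    (1 + I * (Real.sqrt (7 : ℝ) : ℂ)) ^ a * (1 - I * (Real.sqrt (7 : ℝ) : ℂ)) ^ b ≠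
      (1 - I * (Real.sqrt (7 : ℝ) : ℂ)) ^ 6 :=
  mixed_ne_one_sub_pow (by norm_num) I_mul_sqrt_seven_sq hab
    (weilAB_seven_snd_ne_zero a (Nat.pos_of_ne_zero ha) (by omega))

/-- Same bookkeeping for the twelvefold rung (stmt-1261): mixed `(a, b)`, `a + b = 12`, `b ≠ 0`. -/
theorem mixed_eigenvalue_ne_pos_twelve {a b : ℕ} (hab : a + b = 12) (hb : b ≠ 0) :
    (1 + I * (Real.sqrt (7 : ℝ) : ℂ)) ^ a * (1 - I * (Real.sqrt (7 : ℝ) : ℂ)) ^ b ≠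
      (1 + I * (Real.sqrt (7 : ℝ) : ℂ)) ^ 12 :=
  mixed_ne_one_add_pow (by norm_num) I_mul_sqrt_seven_sq hab
    (weilAB_seven_snd_ne_zero b (Nat.pos_of_ne_zero hb) (by omega))

/-- Same bookkeeping for the tenfold rung (stmt-1262, `p = 11`): `a + b = 10`, `b ≠ 0`. -/
theorem mixed_eigenvalue_ne_pos_ten {a b : ℕ} (hab : a + b = 10) (hb : b ≠ 0) :
    (1 + I * (Real.sqrt (11 : ℝ) : ℂ)) ^ a * (1 - I * (Real.sqrt (11 : ℝ) : ℂ)) ^ b ≠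
      (1 + I * (Real.sqrt (11 : ℝ) : ℂ)) ^ 10 :=
  mixed_ne_one_add_pow (by norm_num) I_mul_sqrt_eleven_sq hab
    (weilAB_eleven_snd_ne_zero b (Nat.pos_of_ne_zero hb) (by omega))

/-- The Weil eigenvalues are irrational — in fact not real: `(1+i√7)⁶ ≠ conj`-fixed — so
`(𝟙+φ)^*` has no RATIONAL eigenvector in `W_K`; this is the arithmetic behind "one non-zero
algebraic class in `W_K` suffices" (item 3 of the header). Stated as: the eigenvalue is not the
image of a real number. -/
theorem weilEigenvalue_not_real (r : ℝ) : (1 + I * (Real.sqrt (7 : ℝ) : ℂ)) ^ 6 ≠ (r : ℂ) := by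
  intro h
  rw [weilEigenvalue_values.1] at h
  have him := congrArg Complex.im h
  simp only [Complex.add_im, Complex.mul_im, Complex.I_re, Complex.I_im, Complex.ofReal_re,
    Complex.ofReal_im, Complex.mul_re, mul_zero, zero_mul, sub_zero, add_zero, one_mul,
    zero_add] at him
  -- `him : 0 = 160 * √7` (up to normal form); `√7 ≠ 0` closes it
  norm_num at him

/-! ## §2b A rational description of the Weil plane: `Eig_λ ⊔ Eig_λ̄ = ker (T² - 576·T + 262144)` -/

/-- For a linear endomorphism `f` of a complex vector space and scalars `μ ≠ ν`:
`x ∈ Eig(f, μ) ⊔ Eig(f, ν) ↔ f (f x) - (μ + ν) • f x + (μ ν) • x = 0`. -/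
theorem mem_eigenspace_sup_eigenspace_iff {V : Type*} [AddCommGroup V] [Module ℂ V]
    (f : Module.End ℂ V) {μ ν : ℂ} (hμν : μ ≠ ν) (x : V) :
    x ∈ f.eigenspace μ ⊔ f.eigenspace ν ↔ f (f x) - (μ + ν) • f x + (μ * ν) • x = 0 := by
  constructor
  · intro hx
    obtain ⟨a, ha, b, hb, rfl⟩ := Submodule.mem_sup.1 hx
    rw [Module.End.mem_eigenspace_iff] at ha hb
    simp only [map_add, ha, hb, map_smul]
    module
  · intro h
    have hd : (μ - ν) ≠ 0 := sub_ne_zero.2 hμν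
    have hffx : f (f x) = (μ + ν) • f x - (μ * ν) • x := by
      rw [← sub_eq_zero, ← h]
      module
    set a : V := (μ - ν)⁻¹ • (f x - ν • x) with ha_def
    have hfx : f x = (μ - ν) • a + ν • x := by
      rw [ha_def, smul_smul, mul_inv_cancel₀ hd, one_smul]
      module
    have hfa : f a = μ • a := by
      rw [ha_def, map_smul, map_sub, map_smul, hffx]
      module
    refine Submodule.mem_sup.2 ⟨a, Module.End.mem_eigenspace_iff.2 hfa, x - a, ?_, add_sub_cancel a x⟩
    rw [Module.End.mem_eigenspace_iff, map_sub, hfa, hfx]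
    module

/-- **The Weil plane is cut out by a RATIONAL operator identity** (in the crux `f = (𝟙+φ)^*`):
`x ∈ Eig(f, (1+i√7)⁶) ⊔ Eig(f, (1-i√7)⁶) ↔ f(f x) - 576·f x + 262144·x = 0`; `m(T) = T² - 576T + 8⁶`
is irreducible over `ℚ` (disc `= -7·320²`), so `W` is defined over `ℚ`, `ℂ`-spanned by rational
classes (given universal coefficients), and functorial under maps commuting with `(𝟙+φ)^*` — the
form in which WeilDescending / product arguments use it, and the reason `IsRationalClass` is not
load-bearing (header item 3). -/
theorem mem_weilPlane_iff {V : Type*} [AddCommGroup V] [Module ℂ V] (f : Module.End ℂ V) (x : V) :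
    x ∈ f.eigenspace ((1 + I * (Real.sqrt (7 : ℝ) : ℂ)) ^ 6) ⊔
        f.eigenspace ((1 - I * (Real.sqrt (7 : ℝ) : ℂ)) ^ 6) ↔
      f (f x) - (576 : ℂ) • f x + (262144 : ℂ) • x = 0 := by
  have hs := weilEigenvalue_values
  have ht := I_mul_sqrt_seven_sq
  push_cast at ht
  have hsum : (1 + I * (Real.sqrt (7 : ℝ) : ℂ)) ^ 6 + (1 - I * (Real.sqrt (7 : ℝ) : ℂ)) ^ 6 = 576 := by
    rw [hs.1, hs.2]; ring
  have hprod : (1 + I * (Real.sqrt (7 : ℝ) : ℂ)) ^ 6 * (1 - I * (Real.sqrt (7 : ℝ) : ℂ)) ^ 6 =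
      262144 := by
    rw [hs.1, hs.2]; linear_combination (-25600 : ℂ) * ht
  rw [mem_eigenspace_sup_eigenspace_iff f weilEigenvalue_pos_ne_neg, hsum, hprod]

/-! ## §3 No junk model: the zero abelian variety is the only constructible one, and it has `dim 0`

(Documentation only: any `A` with `A.dim = 6` is a genuine sixfold; `schemeDim (Spec ℂ) = 0`. There
is therefore no degenerate instance of the crux's binders to test, and no Lean witness for any
`¬ ∀ A, A.dim = 6 → …` statement exists in the tree today.)

CYCLE-2 UPDATE (distance to a witness, for future seats). (i) `exists_abelianVariety_dim_eq_zero`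
(`Theorems/HodgeAbelianVarieties/Negative/ExtremeCodimensions`) is the only inhabitant theorem.
(ii) Dimension one is now "one construction away": `WeierstrassCurve.abelianVarietyOfAddHom`
(`Literature/NumberTheory/EllipticCurves/AbelianVarietyModelOfAddHom`) turns a Weierstrass cubic into
an `AbelianVariety K` GIVEN its chord–tangent `add`/`neg` as scheme morphisms (not yet built).
(iii) `E_τ³ = E × E × E` as a smooth projective `ℂ`-SCHEME with a PROVED analytification by the torus
`ℂ³/(ℤ+τℤ)³` exists (`Literature/Barriers/HodgeConjecture/GeneralizedHodgeTrivialReasonsEllipticCurve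
CubedModel`, Grothendieck's trivial-reasons example), with Hodge types computable on the torus side
(`…TorusForms`, `…TorusTypes`).  So the CM witness of §4 (`E⁶`, `E = ℂ/ℤ[(1+√-7)/2]`, `φ = diag √-7`,
a rational Weil class of type `(6,0)+(0,6)`) is THREE constructions away — group-law morphisms, the
CM endomorphism `[√-7]` as a morphism, and the `H¹`/`H⁶` eigen-computation through the torus model —
after which `weilSixfolds_withoutHodgeType_false_of_witness` becomes unconditional (the crux itself,
of course, stays out of reach: its witness would be a counterexample to HC). -/

/-! ## §4 Load-bearing analysis (shape `H → ¬ weakened crux`; `H` = the witness the tree cannot build) -/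

/-- The crux with the Hodge-type hypothesis `IsOfHodgeType 6 A.X 6 3 3 c` DROPPED. FALSE on paper:
`A = E⁶`, `E = ℂ/ℤ[(1+√-7)/2]`, `φ = diag(√-7)`; then `W_K ⊗ ℂ = H^{6,0} ⊕ H^{0,6}` and its non-zero
rational classes are not algebraic (algebraic classes are of type `(3,3)`, Voisin I Prop. 11.20).
So ANY proof of the crux must use the `(3,3)` hypothesis, i.e. must see the Weil-type signature. -/
def WeilSixfoldsSqrtMinus7WithoutHodgeType : Prop :=
  ∀ (A : Literature.AlgebraicGeometry.Motives.AbelianVariety ℂ) (φ : A ⟶ A), A.dim = 6 →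
    φ ≫ φ = -((7 : ℤ) • 𝟙 A) →
    ∀ c : Literature.AlgebraicGeometry.HodgeTheory.complexBetti A.X 6,
      Literature.AlgebraicGeometry.HodgeTheory.IsRationalClass c →
      c ∈ Module.End.eigenspace (Literature.AlgebraicGeometry.HodgeTheory.complexBetti.map
            (𝟙 A + φ).hom.hom.hom 6).hom ((1 + I * (Real.sqrt (7 : ℝ) : ℂ)) ^ 6) ⊔
          Module.End.eigenspace (Literature.AlgebraicGeometry.HodgeTheory.complexBetti.map
            (𝟙 A + φ).hom.hom.hom 6).hom ((1 - I * (Real.sqrt (7 : ℝ) : ℂ)) ^ 6) →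
      c ∈ Literature.AlgebraicGeometry.HodgeTheory.algebraicClasses A.X 3

/-- The CM witness the tree cannot yet construct: a sixfold `(A, φ)`, `φ² = -7`, with a rational
class in the Weil eigenspaces that is NOT algebraic (in print: `E⁶` with `E` CM by `ℤ[(1+√-7)/2]`,
where the Weil plane has Hodge types `(6,0)`, `(0,6)`). [cite: vanGeemen1994HodgeAV, §5.2–5.3]
[cite: VoisinHodgeI2002, Prop. 11.20] -/
def CMSixfoldNonHodgeWeilWitness : Prop :=
  ∃ (A : Literature.AlgebraicGeometry.Motives.AbelianVariety ℂ) (φ : A ⟶ A), A.dim = 6 ∧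
    φ ≫ φ = -((7 : ℤ) • 𝟙 A) ∧
    ∃ c : Literature.AlgebraicGeometry.HodgeTheory.complexBetti A.X 6,
      Literature.AlgebraicGeometry.HodgeTheory.IsRationalClass c ∧
      c ∈ Module.End.eigenspace (Literature.AlgebraicGeometry.HodgeTheory.complexBetti.map
            (𝟙 A + φ).hom.hom.hom 6).hom ((1 + I * (Real.sqrt (7 : ℝ) : ℂ)) ^ 6) ⊔
          Module.End.eigenspace (Literature.AlgebraicGeometry.HodgeTheory.complexBetti.map
            (𝟙 A + φ).hom.hom.hom 6).hom ((1 - I * (Real.sqrt (7 : ℝ) : ℂ)) ^ 6) ∧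
      c ∉ Literature.AlgebraicGeometry.HodgeTheory.algebraicClasses A.X 3

/-- "Any proof must use the `(3,3)` hypothesis": modulo the CM witness, the crux without
`IsOfHodgeType` is false. (Pure logic; the content is in the docstrings above — recorded in Lean so
that the exact witness type a future constructor must inhabit is pinned down.) -/
theorem weilSixfolds_withoutHodgeType_false_of_witness (hW : CMSixfoldNonHodgeWeilWitness) :
    ¬ WeilSixfoldsSqrtMinus7WithoutHodgeType := by
  rintro h
  obtain ⟨A, φ, hdim, hφ, c, hrat, heig, hnot⟩ := hW
  exact hnot (h A φ hdim hφ c hrat heig)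

/-! ## §5 Why it resists: a kill of the crux is a disproof of the summit -/

/-- **Summit-hardness of refutation (unconditional).** Abelian varieties are smooth projective of
dimension `dim A` (the tree's PROVED `AbelianVariety.isSmoothProjective_holds`), so the Hodge
conjecture (the summit statement `_root_.HodgeConjecture`) implies the crux; contrapositively any
refutation of `WeilSixfoldsSqrtMinus7` refutes the Clay problem. Combined with André 1996 (the
catalogued barrier `Andre1996_hodgeClassesOnAbelianVarieties_motivated`): it would also refute the
standard conjecture of Lefschetz type. -/
theorem not_hodgeConjecture_of_not_weilSixfoldsSqrtMinus7 :
    ¬ Theses.HeckePrymWeil.WeilSixfoldsSqrtMinus7 → ¬ _root_.HodgeConjecture := by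
  intro hnot hHC
  apply hnot
  intro A φ hdim _hφ c hrat hhodge _heig
  have hsp : Literature.AlgebraicGeometry.Motives.IsSmoothProjective 6 A.X := by
    have h := (Literature.AlgebraicGeometry.Motives.AbelianVariety.isSmoothProjective_holds (A := A))
    rw [Literature.AlgebraicGeometry.Motives.AbelianVariety.isSmoothProjective, hdim] at h
    exact h
  exact (hHC hsp).2 3 c hrat hhodge

/-- The same for the whole ladder sector: the crux is literally the rung `(p, g') = (7, 2)` of the
route target `HodgeWeilLadder` (so the target implies the crux; contrapositive form). -/
theorem not_hodgeWeilLadder_of_not_weilSixfoldsSqrtMinus7 :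
    ¬ Theses.HeckePrymWeil.WeilSixfoldsSqrtMinus7 → ¬ Theses.HeckePrymWeil.HodgeWeilLadder := by
  intro hnot hL
  apply hnot
  intro A φ hdim hφ c hrat hhodge heig
  have h := hL 7 (by norm_num) (by norm_num) (by norm_num) 2 (by norm_num) 3 (by norm_num) A φ
    hdim (by exact_mod_cast hφ) c hrat hhodge
  exact h (by exact_mod_cast heig)

/-! ## §6 Natural strengthenings of the TYPING, refuted as vacuous (cycle 2; Lean)

Conjugation of singular cochains (`conjClass`) fixes rational classes and maps `Eig(g^*, μ)` to
`Eig(g^*, conj μ)`; `conj((1+i√7)^n) = (1-i√7)^n ≠ (1+i√7)^n` for every `n ≥ 1`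
(`EigenvalueTyping.one_add_I_sqrt7_pow_ne`, imported).  So in EVERY degree a rational class lying in
ONE typed eigenspace is `0`; the single-eigenspace variants of the crux are provable outright (hence
say nothing); the components of a rational class of the plane are conjugate and both non-zero.  Filed
for landing as `Theorems/WeilSixfoldsSqrtMinus7/Negative/WeilPlaneReality.lean` (same statements). -/

section Reality

open Literature.AlgebraicGeometry Literature.AlgebraicGeometry.HodgeTheory
  Literature.AlgebraicTopology.SingularHomology
open Summit.HodgeConjecture.HodgeConjecture.Theorems.WeilTwelvefoldsSqrtMinus7.Negative
  (conjClass_mem_eigenspace_map eq_zero_of_mem_eigenspace_of_mem_eigenspace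
    eq_zero_of_isRationalClass_of_mem_eigenspace conj_one_add_I_sqrt7_pow conj_one_sub_I_sqrt7_pow
    one_add_I_sqrt7_pow_ne)

/-- `conj((1+i√7)^n) ≠ (1+i√7)^n` for `n ≥ 1`: the typed eigenvalue is never real. [folklore] -/
theorem conj_weilEigenvalue_pow_ne (n : ℕ) (hn : 1 ≤ n) :
    starRingEnd ℂ ((1 + I * ((Real.sqrt (7 : ℝ) : ℝ) : ℂ)) ^ n) ≠
      (1 + I * ((Real.sqrt (7 : ℝ) : ℝ) : ℂ)) ^ n := by
  rw [conj_one_add_I_sqrt7_pow]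
  exact (one_add_I_sqrt7_pow_ne n hn).symm

/-- Mirror: `conj((1-i√7)^n) ≠ (1-i√7)^n` for `n ≥ 1`. [folklore] -/
theorem conj_weilEigenvalueBar_pow_ne (n : ℕ) (hn : 1 ≤ n) :
    starRingEnd ℂ ((1 - I * ((Real.sqrt (7 : ℝ) : ℝ) : ℂ)) ^ n) ≠
      (1 - I * ((Real.sqrt (7 : ℝ) : ℝ) : ℂ)) ^ n := by
  rw [conj_one_sub_I_sqrt7_pow]
  exact one_add_I_sqrt7_pow_ne n hn

variable (A : Motives.AbelianVariety ℂ) (ψ : A ⟶ A)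

/-- **A rational class in the `+` typed eigenspace ALONE is zero** — every `A`, `ψ`, degree `k`,
exponent `n ≥ 1`. [cite: VoisinHodgeI2002, Cor. 6.12] -/
theorem rational_mem_plusEigenspace_eq_zero {k n : ℕ} (hn : 1 ≤ n) {c : complexBetti A.X k}
    (hr : IsRationalClass c)
    (hc : c ∈ Module.End.eigenspace (complexBetti.map ψ.hom.hom.hom k).hom
      ((1 + I * ((Real.sqrt (7 : ℝ) : ℝ) : ℂ)) ^ n)) : c = 0 :=
  eq_zero_of_isRationalClass_of_mem_eigenspace _ (conj_weilEigenvalue_pow_ne n hn) hr hc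

/-- Mirror (`-` eigenspace alone). [cite: VoisinHodgeI2002, Cor. 6.12] -/
theorem rational_mem_minusEigenspace_eq_zero {k n : ℕ} (hn : 1 ≤ n) {c : complexBetti A.X k}
    (hr : IsRationalClass c)
    (hc : c ∈ Module.End.eigenspace (complexBetti.map ψ.hom.hom.hom k).hom
      ((1 - I * ((Real.sqrt (7 : ℝ) : ℝ) : ℂ)) ^ n)) : c = 0 :=
  eq_zero_of_isRationalClass_of_mem_eigenspace _ (conj_weilEigenvalueBar_pow_ne n hn) hr hc

/-- **The two components of a rational class of the typed plane are conjugate** (every degree).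
[cite: VoisinHodgeI2002, Cor. 6.12] -/
theorem weilComponents_conj {k n : ℕ} (hn : 1 ≤ n) {c cp cm : complexBetti A.X k}
    (hr : IsRationalClass c)
    (hp : cp ∈ Module.End.eigenspace (complexBetti.map ψ.hom.hom.hom k).hom
      ((1 + I * ((Real.sqrt (7 : ℝ) : ℝ) : ℂ)) ^ n))
    (hm : cm ∈ Module.End.eigenspace (complexBetti.map ψ.hom.hom.hom k).hom
      ((1 - I * ((Real.sqrt (7 : ℝ) : ℝ) : ℂ)) ^ n))
    (hc : c = cp + cm) : conjClass _ k cp = cm := by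
  have hp' := conjClass_mem_eigenspace_map _ hp
  have hm' := conjClass_mem_eigenspace_map _ hm
  rw [conj_one_add_I_sqrt7_pow] at hp'
  rw [conj_one_sub_I_sqrt7_pow] at hm'
  have hcc : conjClass _ k cp + conjClass _ k cm = cp + cm := by
    rw [← conjClass_add, ← hc, hr.conjClass_eq]
  have hd1 : conjClass _ k cp - cm ∈ Module.End.eigenspace (complexBetti.map ψ.hom.hom.hom k).hom
      ((1 - I * ((Real.sqrt (7 : ℝ) : ℝ) : ℂ)) ^ n) := Submodule.sub_mem _ hp' hm
  have heq : conjClass _ k cp - cm = cp - conjClass _ k cm := by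
    rw [sub_eq_sub_iff_add_eq_add, hcc]
  have hd2 : conjClass _ k cp - cm ∈ Module.End.eigenspace (complexBetti.map ψ.hom.hom.hom k).hom
      ((1 + I * ((Real.sqrt (7 : ℝ) : ℝ) : ℂ)) ^ n) := by
    rw [heq]; exact Submodule.sub_mem _ hp hm'
  exact sub_eq_zero.1
    (eq_zero_of_mem_eigenspace_of_mem_eigenspace _ (one_add_I_sqrt7_pow_ne n hn) hd2 hd1)

/-- **Both components of a non-zero rational class of the typed plane are non-zero and non-rational**
(every degree) — the only shape a counterexample class can have. [folklore] -/
theorem weilComponents_ne_zero {k n : ℕ} (hn : 1 ≤ n) {c cp cm : complexBetti A.X k}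
    (hr : IsRationalClass c)
    (hp : cp ∈ Module.End.eigenspace (complexBetti.map ψ.hom.hom.hom k).hom
      ((1 + I * ((Real.sqrt (7 : ℝ) : ℝ) : ℂ)) ^ n))
    (hm : cm ∈ Module.End.eigenspace (complexBetti.map ψ.hom.hom.hom k).hom
      ((1 - I * ((Real.sqrt (7 : ℝ) : ℝ) : ℂ)) ^ n))
    (hc : c = cp + cm) (hc0 : c ≠ 0) :
    cp ≠ 0 ∧ cm ≠ 0 ∧ ¬ IsRationalClass cp ∧ ¬ IsRationalClass cm := by
  have hconj := weilComponents_conj A ψ hn hr hp hm hc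
  have key : IsRationalClass cp → False := fun hxr => by
    have h0 : cp = 0 := rational_mem_plusEigenspace_eq_zero A ψ hn hxr hp
    have h1 := hconj
    rw [h0, conjClass_zero] at h1
    exact hc0 (by rw [hc, h0, ← h1, add_zero])
  have key' : IsRationalClass cm → False := fun hxr => by
    have h0 : cm = 0 := rational_mem_minusEigenspace_eq_zero A ψ hn hxr hm
    have h1 := hconj
    rw [h0] at h1
    have h2 : cp = 0 := by
      have := congrArg (conjClass _ k) h1
      rwa [conjClass_conjClass, conjClass_zero] at this
    exact hc0 (by rw [hc, h0, h2, add_zero])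
  exact ⟨fun h0 => key (h0 ▸ IsRationalClass.zero), fun h0 => key' (h0 ▸ IsRationalClass.zero),
    key, key'⟩

/-- **Refuted-as-vacuous strengthening of the typing (`+` only).**  The variant of the crux whose
Weil-plane hypothesis keeps only `Eig((𝟙+φ)^*, (1+i√7)⁶)` holds outright (every admissible class is
`0`): the `⊔` of both eigenspaces is essential to the meaning of `WeilSixfoldsSqrtMinus7`. [folklore] -/
theorem onlyPlusVariant_six_holds :
    ∀ (A : Motives.AbelianVariety ℂ) (φ : A ⟶ A), A.dim = 6 → φ ≫ φ = -((7 : ℤ) • 𝟙 A) →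
      ∀ c : complexBetti A.X 6, IsRationalClass c → IsOfHodgeType 6 A.X 6 3 3 c →
        c ∈ Module.End.eigenspace (complexBetti.map (𝟙 A + φ).hom.hom.hom 6).hom
              ((1 + I * (Real.sqrt (7 : ℝ) : ℂ)) ^ 6) →
        c ∈ algebraicClasses A.X 3 := by
  intro A φ _ _ c hr _ hc
  rw [rational_mem_plusEigenspace_eq_zero A _ (by norm_num) hr hc]
  exact Submodule.zero_mem _

/-- **Refuted-as-vacuous strengthening of the typing (`-` only).** [folklore] -/
theorem onlyMinusVariant_six_holds :
    ∀ (A : Motives.AbelianVariety ℂ) (φ : A ⟶ A), A.dim = 6 → φ ≫ φ = -((7 : ℤ) • 𝟙 A) →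
      ∀ c : complexBetti A.X 6, IsRationalClass c → IsOfHodgeType 6 A.X 6 3 3 c →
        c ∈ Module.End.eigenspace (complexBetti.map (𝟙 A + φ).hom.hom.hom 6).hom
              ((1 - I * (Real.sqrt (7 : ℝ) : ℂ)) ^ 6) →
        c ∈ algebraicClasses A.X 3 := by
  intro A φ _ _ c hr _ hc
  rw [rational_mem_minusEigenspace_eq_zero A _ (by norm_num) hr hc]
  exact Submodule.zero_mem _

/-- **The crux is equivalent to its COMPONENTWISE form** (non-zero class, two non-zero conjugate
components) — the only shape in which a counterexample can exist, and the shape in which Stub 3 of the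
registered line consumes the crux's class (`∃ c ≠ 0, …`). [folklore] -/
theorem weilSixfoldsSqrtMinus7_iff_componentwise :
    Theses.HeckePrymWeil.WeilSixfoldsSqrtMinus7 ↔
    ∀ (A : Motives.AbelianVariety ℂ) (φ : A ⟶ A), A.dim = 6 → φ ≫ φ = -((7 : ℤ) • 𝟙 A) →
      ∀ c cp cm : complexBetti A.X 6, IsRationalClass c → IsOfHodgeType 6 A.X 6 3 3 c →
        cp ∈ Module.End.eigenspace (complexBetti.map (𝟙 A + φ).hom.hom.hom 6).hom
              ((1 + I * (Real.sqrt (7 : ℝ) : ℂ)) ^ 6) →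
        cm ∈ Module.End.eigenspace (complexBetti.map (𝟙 A + φ).hom.hom.hom 6).hom
              ((1 - I * (Real.sqrt (7 : ℝ) : ℂ)) ^ 6) →
        c = cp + cm → cp ≠ 0 → cm ≠ 0 → c ∈ algebraicClasses A.X 3 := by
  constructor
  · intro h A φ hA hφ c cp cm hr hH hp hm hc _ _
    exact h A φ hA hφ c hr hH (hc ▸ Submodule.add_mem_sup hp hm)
  · intro h A φ hA hφ c hr hH hW
    obtain ⟨cp, hp, cm, hm, hsum⟩ := Submodule.mem_sup.1 hW
    by_cases hc0 : c = 0
    · rw [hc0]; exact Submodule.zero_mem _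
    have hne := weilComponents_ne_zero A _ (by norm_num : 1 ≤ 6) hr hp hm hsum.symm hc0
    exact h A φ hA hφ c cp cm hr hH hp hm hsum.symm hne.1 hne.2.1

end Reality

/-! ## §7 Targets — the five registered stubs of `Lines/hyperbolic-eightfold-descent.lean` (cycle 2)

Pre-emptive pass (no `PICKED.md` yet; `payload.targets = []`).  Per stub: KILL ATTEMPTS and why each
fails, then the Lean-checked bookkeeping the lead can cite.  Summary: NO STUB IS FALSIFIABLE.

* Stub 1 `stub_hyperbolicEightfolds` (C⁺): an instance of HC (rational `(4,4)` Weil classes on a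
  `ℚ(√-7)`-Weil EIGHTFOLD).  Attempts: (i) is the extra structure `h` vacuous/contradictory?  No —
  `h` rational, `∈ N¹H²`, `ψ^*h = 7h` (real eigenvalue, compatible with rationality),
  `Q_h = h⁷ ⌣ (· ⌣ ·)` non-degenerate, `IsHyperbolicWeilType X ψ 4 h` (a `ψ^*`-stable rational
  `Q_h`-Lagrangian `8`-frame): satisfiable (e.g. `J(C₄) × Ĵ(C₄)` with Markman's `h`).  (ii) `h` is NOT
  required to be ample: the stub then covers MORE pairs `(X, ψ)` than the polarised hyperbolic
  component, but each instance is still a case of HC (Weil classes are Hodge classes), so no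
  counterexample short of `¬HC`.  (iii) single-eigenspace variant: vacuous (`onlyPlusVariant_eight`).
* Stub 2 `stub_aimingArithmetic`: TRUE (Landherr).  The summed Hermitian form has signature
  `(n+1, n+1)` automatically (`r₁ r₂ > 0`), and is hyperbolic iff its determinant class is
  `(-1)^{n+1}`, i.e. iff `a·m₁m₂r₁r₂ ∈ Nm(K^×)` (`det H_E = (-1)ⁿ a`, `a > 0`) — achievable since `m₁, m₂`
  are chosen AFTER `E, r₁, r₂` (make `a m₁ m₂ r₁ r₂` a square).  Edge `n = 0` (`V = 0`): choose
  `m₁ r₁ = m₂ r₂`; for `diagWeilForm` one computes `E_c(u, αu) = Σ cᵢ Nm(uᵢ)`, so `u = (1,1)` spans an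
  isotropic `K`-line — PROVED for every `(V, E)`: `stub2_conclusion_rank_one` (rank one of the
  conclusion is free; the stub's content is the jump to rank `n + 1`).  No convention of `diagWeilForm`/`bilinOrthSum` can break this (a common positive
  factor is a square in rank 2; the sign pattern stays `(1,1)`).  Tightness (paper): `m₁ = m₂ = 1`
  does NOT always work (`a = 3` is inert in `ℚ(√-7)`: `DiscriminantClasses.not_isSquare_neg_seven`).
* Stub 3 `stub_hyperbolicPartner`: consistent.  With `h = pr_A^*h_A + pr_B^*h_B` on the eightfold,
  `h⁷ = 21·h_A⁵h_B² + 7·h_A⁶h_B` (the terms `h_A^k h_B^{7-k}` vanish unless `k ≤ 6` and `7-k ≤ 2`), the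
  cross terms `x_A ⌣ y_B` die by degree, so `Q_h = 21·(Q_{h_A} ⊗ vol_B) ⊕ 7·(vol_A ⊗ Q_{h_B})`:
  non-degenerate, and `E`-Lagrangian `K`-subspaces of `H¹(A) ⊕ H¹(B)` are exactly what Stub 2
  produces.  The descent pair is necessarily `b₋ = conj b₊`, both NON-rational
  (`stub3_descentPair_shape`): the stub is typed correctly with `IsRationalClass (b₊ + b₋)`; the
  componentwise-rational variant would be unsatisfiable (`stub3_plus_rational_imp_cup_eq_zero`).
  Unprovable today only for want of a constructed CM surface `E × E` as `AbelianVariety ℂ`.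
* Stub 4 `stub_hodgeTypeExterior`: true (Künneth of Hodge structures).  Junk parameters `p+q ≠ k` make
  the hypothesis `c = 0` (`hodgePQ_eq_bot_of_ne` + injectivity of the model pull-back), harmless.
* Stub 5 `stub_descent`: true (Schoen §10 / Markman §11.5 Step 2, one dimension up; the tree's
  `WeilClassesFourfoldsProofs.weilClassesOf_le_algebraicClasses_of_prod` is already generic in
  `(n₁, n₂)`).  Its sketch uses that `T = (𝟙+ψ)^*` preserves Hodge type `(4,4)` on `A × B` — not among
  the stubs, but PROVED in the tree: `IsOfHodgeType.map_endomorphism` (needs `IsSmoothProjective 8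
  (A.prod B).X`, from `isSmoothProjective_prod` + `isSmoothProjective_holds`), see
  `stub5_hodgeType_transport`.  Bookkeeping it needs, PROVED here: the four eigenvalues
  `λ₊⁸, λ₋⁸, λ₊⁶λ₋², λ₊²λ₋⁶` are pairwise distinct (`stub5_eigenvalues_pairwise_ne`), explicit values
  (`weilEigenvalue_two/four/eight_values`, `stub5_mixed_values`), and the Weil polynomial
  `q(X) = (X-β)(X-β̄) = X² - 1024X + 16777216 ∈ ℤ[X]` with `q(λ±⁸) ≠ 0` (`stub5_weilPolynomial`). -/

section Targets

open Literature.AlgebraicGeometry Literature.AlgebraicGeometry.HodgeTheory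
  Literature.AlgebraicTopology.SingularHomology
open Summit.HodgeConjecture.HodgeConjecture.Theorems.WeilTwelvefoldsSqrtMinus7.Negative
  (one_add_I_sqrt7_pow_ne mixed_eq_plus_iff mixed_eq_minus_iff one_add_I_sqrt7_ne_zero
    one_sub_I_sqrt7_ne_zero)

/-! ### Stub 5: eigenvalue bookkeeping in degrees 2, 4, 8 -/

/-- `(1 ± i√7)² = -6 ± 2·i√7` (the partner surface, degree 2). [folklore] -/
theorem weilEigenvalue_two_values :
    (1 + I * (Real.sqrt (7 : ℝ) : ℂ)) ^ 2 = -6 + 2 * (I * (Real.sqrt (7 : ℝ) : ℂ)) ∧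
    (1 - I * (Real.sqrt (7 : ℝ) : ℂ)) ^ 2 = -6 - 2 * (I * (Real.sqrt (7 : ℝ) : ℂ)) := by
  have h2 : weilAB 7 2 = (-6, 2) := by decide
  refine ⟨?_, ?_⟩
  · rw [one_add_pow_eq I_mul_sqrt_seven_sq 2, h2]; push_cast; ring
  · rw [one_sub_pow_eq I_mul_sqrt_seven_sq 2, h2]; push_cast; ring

/-- `(1 ± i√7)⁴ = 8 ∓ 24·i√7`. [folklore] -/
theorem weilEigenvalue_four_values :
    (1 + I * (Real.sqrt (7 : ℝ) : ℂ)) ^ 4 = 8 - 24 * (I * (Real.sqrt (7 : ℝ) : ℂ)) ∧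
    (1 - I * (Real.sqrt (7 : ℝ) : ℂ)) ^ 4 = 8 + 24 * (I * (Real.sqrt (7 : ℝ) : ℂ)) := by
  have h4 : weilAB 7 4 = (8, -24) := by decide
  refine ⟨?_, ?_⟩
  · rw [one_add_pow_eq I_mul_sqrt_seven_sq 4, h4]; push_cast; ring
  · rw [one_sub_pow_eq I_mul_sqrt_seven_sq 4, h4]; push_cast; ring

/-- `(1 ± i√7)⁸ = -3968 ∓ 384·i√7` (the product eightfold, degree 8; norm `8⁸ = 3968² + 7·384²`).
[folklore] -/
theorem weilEigenvalue_eight_values :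
    (1 + I * (Real.sqrt (7 : ℝ) : ℂ)) ^ 8 = -3968 - 384 * (I * (Real.sqrt (7 : ℝ) : ℂ)) ∧
    (1 - I * (Real.sqrt (7 : ℝ) : ℂ)) ^ 8 = -3968 + 384 * (I * (Real.sqrt (7 : ℝ) : ℂ)) := by
  have h8 : weilAB 7 8 = (-3968, -384) := by decide
  refine ⟨?_, ?_⟩
  · rw [one_add_pow_eq I_mul_sqrt_seven_sq 8, h8]; push_cast; ring
  · rw [one_sub_pow_eq I_mul_sqrt_seven_sq 8, h8]; push_cast; ring

/-- The MIXED eigenvalues of `T = (𝟙 + φ × φ_B)^*` on `pr_A^*W(A) ⌣ pr_B^*W(B)`: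
`β = λ₊⁶λ₋² = 512 - 1536·i√7`, `β̄ = λ₊²λ₋⁶ = 512 + 1536·i√7`. [folklore] -/
theorem stub5_mixed_values :
    (1 + I * (Real.sqrt (7 : ℝ) : ℂ)) ^ 6 * (1 - I * (Real.sqrt (7 : ℝ) : ℂ)) ^ 2 =
        512 - 1536 * (I * (Real.sqrt (7 : ℝ) : ℂ)) ∧
    (1 + I * (Real.sqrt (7 : ℝ) : ℂ)) ^ 2 * (1 - I * (Real.sqrt (7 : ℝ) : ℂ)) ^ 6 =
        512 + 1536 * (I * (Real.sqrt (7 : ℝ) : ℂ)) := by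
  have ht := I_mul_sqrt_seven_sq
  push_cast at ht
  refine ⟨?_, ?_⟩
  · rw [weilEigenvalue_values.1, weilEigenvalue_two_values.2]
    linear_combination (-320 : ℂ) * ht
  · rw [weilEigenvalue_values.2, weilEigenvalue_two_values.1]
    linear_combination (-320 : ℂ) * ht

/-- **Stub 5's four eigenvalues are pairwise distinct**: `λ₊⁸, λ₋⁸, β = λ₊⁶λ₋², β̄ = λ₊²λ₋⁶`
(`λ± = 1 ± i√7`) — so the Weil projector `q(T)`, `q(X) = (X-β)(X-β̄)`, kills exactly the mixed pieces.
[folklore] -/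
theorem stub5_eigenvalues_pairwise_ne :
    (1 + I * (Real.sqrt (7 : ℝ) : ℂ)) ^ 8 ≠ (1 - I * (Real.sqrt (7 : ℝ) : ℂ)) ^ 8 ∧
    (1 + I * (Real.sqrt (7 : ℝ) : ℂ)) ^ 6 * (1 - I * (Real.sqrt (7 : ℝ) : ℂ)) ^ 2 ≠
      (1 + I * (Real.sqrt (7 : ℝ) : ℂ)) ^ 8 ∧
    (1 + I * (Real.sqrt (7 : ℝ) : ℂ)) ^ 6 * (1 - I * (Real.sqrt (7 : ℝ) : ℂ)) ^ 2 ≠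
      (1 - I * (Real.sqrt (7 : ℝ) : ℂ)) ^ 8 ∧
    (1 + I * (Real.sqrt (7 : ℝ) : ℂ)) ^ 2 * (1 - I * (Real.sqrt (7 : ℝ) : ℂ)) ^ 6 ≠
      (1 + I * (Real.sqrt (7 : ℝ) : ℂ)) ^ 8 ∧
    (1 + I * (Real.sqrt (7 : ℝ) : ℂ)) ^ 2 * (1 - I * (Real.sqrt (7 : ℝ) : ℂ)) ^ 6 ≠
      (1 - I * (Real.sqrt (7 : ℝ) : ℂ)) ^ 8 ∧
    (1 + I * (Real.sqrt (7 : ℝ) : ℂ)) ^ 6 * (1 - I * (Real.sqrt (7 : ℝ) : ℂ)) ^ 2 ≠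
      (1 + I * (Real.sqrt (7 : ℝ) : ℂ)) ^ 2 * (1 - I * (Real.sqrt (7 : ℝ) : ℂ)) ^ 6 := by
  refine ⟨one_add_I_sqrt7_pow_ne 8 (by norm_num), ?_, ?_, ?_, ?_, ?_⟩
  · intro h; exact absurd ((mixed_eq_plus_iff 6 2).1 h) (by norm_num)
  · intro h; exact absurd ((mixed_eq_minus_iff 6 2).1 h) (by norm_num)
  · intro h; exact absurd ((mixed_eq_plus_iff 2 6).1 h) (by norm_num)
  · intro h; exact absurd ((mixed_eq_minus_iff 2 6).1 h) (by norm_num)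
  · intro h
    -- divide by `λ₊² λ₋²`: `λ₊⁴ = λ₋⁴`, contradicting separation at exponent 4
    have h' : (1 + I * (Real.sqrt (7 : ℝ) : ℂ)) ^ 2 * (1 - I * (Real.sqrt (7 : ℝ) : ℂ)) ^ 2 *
        ((1 + I * (Real.sqrt (7 : ℝ) : ℂ)) ^ 4 - (1 - I * (Real.sqrt (7 : ℝ) : ℂ)) ^ 4) = 0 := by
      linear_combination h
    rcases mul_eq_zero.1 h' with h1 | h1
    · rcases mul_eq_zero.1 h1 with h2 | h2
      · exact one_add_I_sqrt7_ne_zero (pow_eq_zero_iff (by norm_num) |>.1 h2)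
      · exact one_sub_I_sqrt7_ne_zero (pow_eq_zero_iff (by norm_num) |>.1 h2)
    · exact one_add_I_sqrt7_pow_ne 4 (by norm_num) (sub_eq_zero.1 h1)

/-- **The Weil polynomial of Stub 5 is integral and invertible on the pure pieces**:
`β + β̄ = 1024`, `β β̄ = 8⁸ = 16777216` (so `q(X) = X² - 1024·X + 16777216 ∈ ℤ[X]` and `q(T)` maps
rational classes to rational classes), and `q(λ₊⁸) ≠ 0`, `q(λ₋⁸) ≠ 0`. [folklore] -/
theorem stub5_weilPolynomial :
    (1 + I * (Real.sqrt (7 : ℝ) : ℂ)) ^ 6 * (1 - I * (Real.sqrt (7 : ℝ) : ℂ)) ^ 2 +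
        (1 + I * (Real.sqrt (7 : ℝ) : ℂ)) ^ 2 * (1 - I * (Real.sqrt (7 : ℝ) : ℂ)) ^ 6 = 1024 ∧
    (1 + I * (Real.sqrt (7 : ℝ) : ℂ)) ^ 6 * (1 - I * (Real.sqrt (7 : ℝ) : ℂ)) ^ 2 *
        ((1 + I * (Real.sqrt (7 : ℝ) : ℂ)) ^ 2 * (1 - I * (Real.sqrt (7 : ℝ) : ℂ)) ^ 6) = 16777216 ∧
    ((1 + I * (Real.sqrt (7 : ℝ) : ℂ)) ^ 8) ^ 2 - 1024 * (1 + I * (Real.sqrt (7 : ℝ) : ℂ)) ^ 8 +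
        16777216 ≠ 0 ∧
    ((1 - I * (Real.sqrt (7 : ℝ) : ℂ)) ^ 8) ^ 2 - 1024 * (1 - I * (Real.sqrt (7 : ℝ) : ℂ)) ^ 8 +
        16777216 ≠ 0 := by
  have ht := I_mul_sqrt_seven_sq
  push_cast at ht
  obtain ⟨hb, hbb⟩ := stub5_mixed_values
  obtain ⟨hne, h1, h2, h3, h4, _⟩ := stub5_eigenvalues_pairwise_ne
  refine ⟨by rw [hb, hbb]; ring, by rw [hb, hbb]; linear_combination (-2359296 : ℂ) * ht, ?_, ?_⟩
  · -- `q(λ₊⁸) = (λ₊⁸ - β)(λ₊⁸ - β̄)`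
    have hq : ((1 + I * (Real.sqrt (7 : ℝ) : ℂ)) ^ 8) ^ 2 - 1024 * (1 + I * (Real.sqrt (7 : ℝ) : ℂ)) ^ 8 +
        16777216 = ((1 + I * (Real.sqrt (7 : ℝ) : ℂ)) ^ 8 - (512 - 1536 * (I * (Real.sqrt (7 : ℝ) : ℂ)))) *
          ((1 + I * (Real.sqrt (7 : ℝ) : ℂ)) ^ 8 - (512 + 1536 * (I * (Real.sqrt (7 : ℝ) : ℂ)))) := by
      linear_combination (2359296 : ℂ) * ht
    rw [hq, ← hb, ← hbb]
    exact mul_ne_zero (sub_ne_zero.2 (Ne.symm h1)) (sub_ne_zero.2 (Ne.symm h3))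
  · have hq : ((1 - I * (Real.sqrt (7 : ℝ) : ℂ)) ^ 8) ^ 2 - 1024 * (1 - I * (Real.sqrt (7 : ℝ) : ℂ)) ^ 8 +
        16777216 = ((1 - I * (Real.sqrt (7 : ℝ) : ℂ)) ^ 8 - (512 - 1536 * (I * (Real.sqrt (7 : ℝ) : ℂ)))) *
          ((1 - I * (Real.sqrt (7 : ℝ) : ℂ)) ^ 8 - (512 + 1536 * (I * (Real.sqrt (7 : ℝ) : ℂ)))) := by
      linear_combination (2359296 : ℂ) * ht
    rw [hq, ← hb, ← hbb]
    exact mul_ne_zero (sub_ne_zero.2 (Ne.symm h2)) (sub_ne_zero.2 (Ne.symm h4))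

/-! ### Stub 2: the rank-one part of its conclusion holds for EVERY `(V, E)` (conventions as read) -/

/-- For weights `(c, -c)` the diagonal `K`-line `K·(1,1)` of `K²` is totally isotropic for the tree's
diagonal Weil form: `E_{(c,-c)}(k·(1,1), k'·(1,1)) = (c - c)(re k · im k' - im k · re k') = 0` — the
simplest hyperbolic plane `⟨x, -x⟩` in which Stub 2's induction terminates. [folklore] -/
theorem stub2_diagWeilForm_pair_diag_isotropic {K : Type} [Field K] [Algebra ℚ K] {α : K}
    (hα : α * α = algebraMap ℚ K (-7))
    (hK : ∀ k : K, ∃ a b : ℚ, k = algebraMap ℚ K a + algebraMap ℚ K b * α) (c : ℚ) (k k' : K) :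
    Motives.diagWeilForm (d := 7) (by norm_num) hα hK (Pi.basisFun K (Fin 2)) ![c, -c]
      (fun _ => k) (fun _ => k') = 0 := by
  rw [Motives.diagWeilForm_apply, Fin.sum_univ_two]
  simp only [Module.Basis.coord_apply, Pi.basisFun_repr, Matrix.cons_val_zero, Matrix.cons_val_one]
  ring

/-- **Stub 2's conclusion in rank ONE holds for every `(V, E)` and every `r₁ r₂ > 0`** — in particular
the degenerate case `n = 0` of `stub_aimingArithmetic` (required rank `n + 1 = 1`) is TRUE with all its
hypotheses on `E, P, N` dropped: choose positive integers with `m₁ r₁ = m₂ r₂`; then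
`L = K·(0, (1,1)) ⊆ V × K²` is a `K`-line on which `E ⊕ E_{(m₁r₁, -m₂r₂)}` vanishes identically.  (So the
sign conventions of `diagWeilForm`/`bilinOrthSum` are as the planner reads them; the content of the stub
is the jump from rank `1` to rank `n + 1`, i.e. Landherr.) [folklore] -/
theorem stub2_conclusion_rank_one (K : Type) [Field K] [Algebra ℚ K] (α : K)
    (hα : α * α = algebraMap ℚ K (-7))
    (hK : ∀ k : K, ∃ a b : ℚ, k = algebraMap ℚ K a + algebraMap ℚ K b * α)
    (V : Type) [AddCommGroup V] [Module ℚ V] [Module K V] [IsScalarTower ℚ K V]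
    (E : LinearMap.BilinForm ℚ V) (r₁ r₂ : ℚ) (hr : 0 < r₁ * r₂) :
    ∃ m₁ m₂ : ℕ, 0 < m₁ ∧ 0 < m₂ ∧
      ∃ L : Submodule K (V × (Fin 2 → K)), Module.finrank K L = 1 ∧
        ∀ x ∈ L, ∀ y ∈ L,
          Motives.bilinOrthSum E
            (Motives.diagWeilForm (d := 7) (by norm_num) hα hK (Pi.basisFun K (Fin 2))
              ![(m₁ : ℚ) * r₁, -((m₂ : ℚ) * r₂)]) x y = 0 := by
  have hr1 : r₁ ≠ 0 := by rintro rfl; simp at hr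
  set q : ℚ := r₂ / r₁ with hq_def
  have hq : 0 < q := by
    have : q = (r₁ * r₂) / (r₁ * r₁) := by
      rw [hq_def]; field_simp
    rw [this]; exact div_pos hr (mul_self_pos.2 hr1)
  have hnum : 0 < q.num := Rat.num_pos.2 hq
  refine ⟨q.num.toNat, q.den, by omega, q.den_pos, ?_⟩
  have hw : ((q.num.toNat : ℕ) : ℚ) * r₁ = ((q.den : ℕ) : ℚ) * r₂ := by
    have h1 : ((q.num.toNat : ℕ) : ℚ) = (q.num : ℚ) := by
      have : ((q.num.toNat : ℕ) : ℤ) = q.num := Int.toNat_of_nonneg hnum.le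
      exact_mod_cast this
    rw [h1, ← Rat.mul_den_eq_num q, hq_def]
    field_simp
  set w : V × (Fin 2 → K) := (0, fun _ => 1) with hw_def
  have hw0 : w ≠ 0 := by
    intro h
    have := congrArg (fun z : V × (Fin 2 → K) => z.2 0) h
    simp [hw_def] at this
  refine ⟨K ∙ w, finrank_span_singleton hw0, ?_⟩
  intro x hx y hy
  obtain ⟨a, rfl⟩ := Submodule.mem_span_singleton.1 hx
  obtain ⟨a', rfl⟩ := Submodule.mem_span_singleton.1 hy
  have hneg : -(((q.den : ℕ) : ℚ) * r₂) = -(((q.num.toNat : ℕ) : ℚ) * r₁) := by rw [hw]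
  rw [Motives.bilinOrthSum_apply, hneg]
  simp only [hw_def, Prod.smul_mk, smul_zero, map_zero, zero_add]
  have h1 : (a • fun _ : Fin 2 => (1 : K)) = fun _ => a := by
    funext i; simp
  have h2 : (a' • fun _ : Fin 2 => (1 : K)) = fun _ => a' := by
    funext i; simp
  rw [h1, h2]
  exact stub2_diagWeilForm_pair_diag_isotropic hα hK _ a a'

/-! ### Stub 5 / Stub 4: Hodge-type transport along `T = (𝟙 + ψ)^*` is already a theorem -/

/-- **`T = (𝟙 + ψ)^*` preserves Hodge type `(4,4)` on the product eightfold** — the step of Stub 5's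
sketch ("`Q = q(T)P`, `TQ` are rational `(4,4)` Weil classes") that no stub states: it is the tree's
`IsOfHodgeType.map_endomorphism` (GAGA functoriality inside ONE Hodge model), fed with
`isSmoothProjective_holds`.  Stated for any abelian variety `X` of dimension `8` and any endomorphism.
[cite: VoisinHodgeI2002, §7.3.2] -/
theorem stub5_hodgeType_transport (X : Motives.AbelianVariety ℂ) (g : X ⟶ X) (hX : X.dim = 8)
    {u : complexBetti X.X 8} (hu : IsOfHodgeType 8 X.X 8 4 4 u) :
    IsOfHodgeType 8 X.X 8 4 4 (complexBetti.map g.hom.hom.hom 8 u) := by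
  have hsp : Motives.IsSmoothProjective 8 X.X := by
    have h := (Motives.AbelianVariety.isSmoothProjective_holds (A := X))
    rw [Motives.AbelianVariety.isSmoothProjective, hX] at h
    exact h
  exact hu.map_endomorphism hsp g.hom.hom.hom

/-! ### Stub 3: the shape of a descent pair on the partner surface (degree 2) -/

variable (B : Motives.AbelianVariety ℂ) (φB : B ⟶ B)

/-- **A RATIONAL `b₊` kills the descent pair**: on the partner surface a rational class in
`Eig((𝟙+φ_B)^*, (1+i√7)²)` is `0`, so `b₊ ⌣ η = 0` for every `η` — the componentwise-rational
strengthening of Stub 3's pair `(b₊, b₋, η)` is unsatisfiable; Stub 3 as typed (only `b₊ + b₋`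
rational) avoids it. [folklore] -/
theorem stub3_plus_rational_imp_cup_eq_zero {bp : complexBetti B.X 2} (hr : IsRationalClass bp)
    (hp : bp ∈ Module.End.eigenspace (complexBetti.map (𝟙 B + φB).hom.hom.hom 2).hom
      ((1 + I * (Real.sqrt (7 : ℝ) : ℂ)) ^ 2))
    (η : complexBetti B.X 2) : cupProduct (show 2 + 2 = 4 from rfl) bp η = 0 := by
  rw [rational_mem_plusEigenspace_eq_zero B _ (by norm_num) hr hp, map_zero, LinearMap.zero_apply]

/-- **Shape of every descent pair** (from Stub 3's typed hypotheses alone): `b₊`, `b₋` are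
non-rational, non-zero, and `conj b₊ = b₋`. [folklore] -/
theorem stub3_descentPair_shape {bp bm η : complexBetti B.X 2}
    (hp : bp ∈ Module.End.eigenspace (complexBetti.map (𝟙 B + φB).hom.hom.hom 2).hom
      ((1 + I * (Real.sqrt (7 : ℝ) : ℂ)) ^ 2))
    (hm : bm ∈ Module.End.eigenspace (complexBetti.map (𝟙 B + φB).hom.hom.hom 2).hom
      ((1 - I * (Real.sqrt (7 : ℝ) : ℂ)) ^ 2))
    (hr : IsRationalClass (bp + bm)) (hcup : cupProduct (show 2 + 2 = 4 from rfl) bp η ≠ 0) :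
    ¬ IsRationalClass bp ∧ ¬ IsRationalClass bm ∧ bp ≠ 0 ∧ bm ≠ 0 ∧ conjClass _ 2 bp = bm := by
  have h0 : bp + bm ≠ 0 := by
    intro h
    -- `bp + bm = 0` puts `bp = -bm` in both eigenspaces, so `bp = 0`
    have hbm : bp ∈ Module.End.eigenspace (complexBetti.map (𝟙 B + φB).hom.hom.hom 2).hom
        ((1 - I * (Real.sqrt (7 : ℝ) : ℂ)) ^ 2) := by
      have : bp = -bm := eq_neg_of_add_eq_zero_left h
      rw [this]; exact Submodule.neg_mem _ hm
    have hz := Summit.HodgeConjecture.HodgeConjecture.Theorems.WeilTwelvefoldsSqrtMinus7.Negative.eq_zero_of_mem_eigenspace_of_mem_eigenspace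
      _ (one_add_I_sqrt7_pow_ne 2 (by norm_num)) hp hbm
    exact hcup (by rw [hz, map_zero, LinearMap.zero_apply])
  obtain ⟨hp0, hm0, hpr, hmr⟩ := weilComponents_ne_zero B _ (by norm_num : 1 ≤ 2) hr hp hm rfl h0
  exact ⟨hpr, hmr, hp0, hm0, weilComponents_conj B _ (by norm_num) hr hp hm rfl⟩

/-! ### Stub 1: the single-eigenspace variant of its Weil-plane hypothesis is vacuous (degree 8) -/

variable (X : Motives.AbelianVariety ℂ) (ψ : X ⟶ X)

/-- A rational class of the eightfold in `Eig((𝟙+ψ)^*, (1+i√7)⁸)` ALONE is `0`, hence algebraic for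
free: Stub 1 is correctly typed with the `⊔` (as the crux is). [folklore] -/
theorem onlyPlusVariant_eight {u : complexBetti X.X 8} (hr : IsRationalClass u)
    (hu : u ∈ Module.End.eigenspace (complexBetti.map (𝟙 X + ψ).hom.hom.hom 8).hom
      ((1 + I * (Real.sqrt (7 : ℝ) : ℂ)) ^ 8)) :
    u ∈ algebraicClasses X.X 4 := by
  rw [rational_mem_plusEigenspace_eq_zero X _ (by norm_num) hr hu]
  exact Submodule.zero_mem _

end Targets

/-! ## §8 Junk-model attack on `IsOfHodgeType` — the near-miss, pinned in Lean (cycle 2)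

The ONLY hypothesis of the crux with an existential over a structure is
`IsOfHodgeType 6 A.X 6 3 3 c = ∃ M : HodgeModel 6 A.X, M.pullback 6 c ∈ M.hodgePQ 6 3 3`.  If an exotic
`HodgeModel` could declare a NON-`(3,3)` rational Weil class to be `(3,3)`, the crux (and the summit)
would be false for a junk reason.  The header (item 8) explains why no exotic model exists: the field
`isAnalytification` pins the complex structure through regular functions on AFFINE opens (Osgood), and
natural de Rham comparison families differ by a universal scalar (Thom realisation + connected sums).
Below: the two tree-level facts this rests on, restated so that an auditor sees exactly what is
assumed where (`IsAnalytification.unique` and `hodgePQ_independent_of_hodgeModel` are NAMED FACTS of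
the tree, not yet theorems), and the observation that the crux only ever USES `IsOfHodgeType` through
Stub 4 / `map_endomorphism`, both of which work inside one model. -/

section JunkModel

open Literature.AlgebraicGeometry Literature.AlgebraicGeometry.HodgeTheory

/-- What an exotic-model refutation would have to produce: a Hodge model of a sixfold in which a
rational Weil class that is NOT algebraic is nevertheless of type `(3,3)`.  By item 8 of the header no
such model exists (analytification pinned on affine opens; de Rham comparison unique up to a scalar),
so this `Prop` is (believed) FALSE — it is recorded, not assumed. [folklore] -/
def ExoticHodgeModelWitness : Prop :=
  ∃ (A : Motives.AbelianVariety ℂ) (φ : A ⟶ A), A.dim = 6 ∧ φ ≫ φ = -((7 : ℤ) • 𝟙 A) ∧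
    ∃ (c : complexBetti A.X 6) (M : HodgeModel 6 A.X), IsRationalClass c ∧
      M.pullback 6 c ∈ M.hodgePQ 6 3 3 ∧
      c ∈ Module.End.eigenspace (complexBetti.map (𝟙 A + φ).hom.hom.hom 6).hom
            ((1 + I * (Real.sqrt (7 : ℝ) : ℂ)) ^ 6) ⊔
          Module.End.eigenspace (complexBetti.map (𝟙 A + φ).hom.hom.hom 6).hom
            ((1 - I * (Real.sqrt (7 : ℝ) : ℂ)) ^ 6) ∧
      c ∉ algebraicClasses A.X 3

/-- **The junk-model route to a kill, made explicit**: an exotic-model witness IS a refutation of the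
crux (pure logic — `IsOfHodgeType` is the `∃` over models).  Since the crux is an instance of HC
(§5), such a witness would also refute the Clay problem; item 8 of the header is the argument that
none exists (so this implication is recorded as the precise shape of the near-miss, cf.
`CMSixfoldNonHodgeWeilWitness` of §4, which it would instantiate with `A = E⁶` read through the
structure `E³ × Ē³` if that structure were admissible). [folklore] -/
theorem not_weilSixfoldsSqrtMinus7_of_exoticHodgeModelWitness (h : ExoticHodgeModelWitness) :
    ¬ Theses.HeckePrymWeil.WeilSixfoldsSqrtMinus7 := by
  obtain ⟨A, φ, hA, hφ, c, M, hr, hM, hW, hnot⟩ := h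
  exact fun hcrux => hnot (hcrux A φ hA hφ c hr ⟨M, hM⟩ hW)

end JunkModel


end Summit.HodgeConjecture.HodgeConjecture.Cruxes.WeilSixfoldsSqrtMinus7.Disproof

end
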